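import Literature.NumberTheory.EllipticCurves.ModularCurvePeriodRatio
import Literature.NumberTheory.EllipticCurves.ImaginaryPeriod
import HarnessLib

/-!
# The Néron IMAGINARY period versus the minus lattice period of the newform at `p = 2 ∤ N` with `E[2]` irreducible

Topic `NumberTheory/EllipticCurves`; namespace `Literature.NumberTheory.EllipticCurves`. TWO named facts (`def … : Prop`, D-0014) and
nothing else — the second (`…_of_not_four_dvd`, appended 2026-08-28 for cell `bsd-f1-sign2`, -an ask D-an-87) is the same chain with the Manin
step taken from Česnavičius 2018 instead of Abbes–Ullmo 1996, valid whenever `4 ∤ N` (see «The `4 ∤ N` variant» below); the first: the `Ω⁻` twin of `realPeriodRat_eq_unit_mul_plusPeriod_two` (file `ModularCurvePeriodRatio`), stated for the crux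
`MainConjectureTransportAlignedAtTwo` of `BirchSwinnertonDyer` (stmt-BirchSwinnertonDyer-22296, route `AlignedTransportAtTwo`, line `birth`,
lead seat `bsd-line-att-p1` g7), where it makes Birch's constant for a NEGATIVE quadratic twist a `2`-adic unit (files
`Summits/…/Theorems/AlignedTransportAtTwoMainConjectureTransportAlignedAtTwoNegTwist{Congruence,Kida}.lean`: the odd Birch lemma gives
`c²·|d|·(Ω⁺_{f_A})² = (Ω⁻_{f_W})²`, V. Pal's theorem for `d < 0` gives `Ω(A)·√|d| = c_∞(W)·|Ω⁻(W)|`).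

## The two periods

* `c_∞(W)·|Ω⁻(W)|` with `|Ω⁻(W)| = W.imaginaryPeriodRat` (file `ImaginaryPeriod`: the positive generator of `Λ_W ∩ iℝ`, V. Pal's `Ω⁻(E)` in absolute
  value, Pal 2012 p. 1514, for the period lattice `Λ_W` of the model `W` — the Néron lattice when `W` is globally minimal) and
  `c_∞(W) = numRealComponents (W ⊗ ℝ) ∈ {1, 2}`: in BOTH lattice types this product is twice the positive generator of `im Λ_W`
  (rectangular `Λ = ℤΩ₁ ⊕ ℤiΩ₂`: `Λ ∩ iℝ = ℤiΩ₂`, `im Λ = ℤΩ₂`, `c_∞ = 2`; rhombic `Λ = ℤω ⊕ ℤω̄`: `Λ ∩ iℝ = ℤ·2i im ω`, `im Λ = ℤ im ω`, `c_∞ = 1`),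
  i.e. the "components included" imaginary period — exactly as `Ω(W) = realPeriodRat W` is twice the positive generator of `re Λ_W`.
* `Ω⁻_f = minusPeriod f` (`ModularSymbols`): the positive real number with `im Λ_f = ℤ·Ω⁻_f/2`.

## The printed chain (the same three steps as `ModularCurvePeriodRatio`, read on imaginary parts)

For `W/ℚ` globally minimal, `f` its newform, `2 ∤ N` (good reduction at `2`) and `E[2]` irreducible: (1) `Λ(ω_{E₀}) = c₀Λ_f` for the optimal curve
`E₀` (Edixhoven 1991, Prop. 2), hence `im Λ_{E₀} = c₀·im Λ_f`; (2) `2 ∤ c₀` (Abbes–Ullmo 1996, Thm. A: `p ∣ c₀ ⇒ p ∣ N`); (3) a cyclic `ℚ`-isogeny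
`θ : E₀ → W` of degree `d` has `2 ∤ d` (no rational `2`-isogeny since `E[2]` is irreducible), `θ^*ω_W = a·ω_{E₀}` with `a ∣ d`, and
`a·Λ_{E₀} ⊆ Λ_W` of index `d`, so `[im Λ_W : im(aΛ_{E₀})] = e⁻ ∣ d`; altogether `c_∞(W)·|Ω⁻(W)| = u·Ω⁻_f` with `u = |c₀ a|/e⁻`, `|u|₂ = 1` —
Greenberg–Vatsal 2000, §3, Remark 3.4 ("if `E[p]` is irreducible … the Néron periods of any isogenous curve differ from those of `E` by a `p`-adic
unit"), stated there for the canonical periods `Ω_E^±` of BOTH signs. Weaker than the sources (conclusion only up to a rational `2`-adic unit).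
Literature-prover triage: size L (steps 1–3 are statements only in the tree); no `_holds` here.

## The `4 ∤ N` variant (second fact)

Step (2) is the only place where «good reduction at 2» (`2 ∤ N`) enters.  Česnavičius 2018 (Compositio 154), Theorem 1.2 [materialised
corpus:paper:arxiv-1703.02951 p. 3, L21–23, read 2026-08-28]: «For an `n ∈ ℤ_{≥1}`, a subgroup `H ⊂ GL₂(ℤ̂)` with `Γ₁(n) ⊂ H ⊂ Γ₀(n)`, a new elliptic
optimal quotient `π : J_H ↠ E`, and a prime `p`, if `p² ∤ n`, then `v_p(c_π) = 0` and `π` induces a smooth morphism on Néron models over `ℤ_p`.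
In particular, [Manin's conjecture `c_π = 1`] holds in the case when `E` is semistable.»  With `H = Γ₀(N)`, `p = 2`: `4 ∤ N ⇒ 2 ∤ c₀` for the
`X₀(N)`-optimal curve `E₀` of the class — so steps (1) Edixhoven 1991 Prop. 2, (2′) Česnavičius 2018 Thm. 1.2, (3) odd isogeny degree (GV 2000 §3
Rem. 3.4) and Pal's `Ω⁻` give the SAME conclusion for every globally minimal `W/ℚ` with `4 ∤ N_W` (good OR multiplicative reduction at `2`) and
`ρ̄_{W,2}` irreducible.  (Earlier partial result towards (2′): Agashe–Ribet–Stein 2006 Thm. 2.7, `p ∣ c ⇒ p² ∣ N ∨ p ∣ m_E`; Česnavičius p. 3 L28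
lists Mazur 1978 Cor. 4.1, Abbes–Ullmo 1996 Thm. A, ARS 2006 Thm. 2.7, Česnavičius 2016 Thm. 1.5 as the previously known cases, «in particular,
the case of an odd p».)  The first fact is the special case `2 ∤ N` of the second (`HasGoodReductionAtPrime 2 ⟺ ¬ 2 ∣ N_W`, tree
`dvd_conductorNorm_iff_not_hasGoodReductionAtPrime` in `ModularityVersionApProofs`, not imported here to keep this statement file light).
Weaker than the sources (conclusion only up to a rational `2`-adic unit).  Size L; no `_holds`.

## References

* R. Greenberg, V. Vatsal, Invent. Math. 142 (2000) 17–63, §3, Remark 3.4. [GreenbergVatsal2000]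
* A. Abbes, E. Ullmo, Compositio Math. 103 (1996) 269–286, Thm. A. [AbbesUllmo1996]
* B. Edixhoven, Progr. Math. 89 (1991), Prop. 2 and §1. [EdixhovenManin1991]
* V. Pal, Proc. Amer. Math. Soc. 140 (2012) 1513–1525, p. 1514 (`Ω⁻`). [Pal2012]
* K. Česnavičius, The Manin constant in the semistable case, Compositio Math. 154 (2018) 1889–1920, Thm. 1.2 (arXiv:1703.02951 p. 3). [Cesnavicius2018]
* A. Agashe, K. Ribet, W. A. Stein, The Manin constant, Pure Appl. Math. Q. 2 (2006) 617–636, Thm. 2.7. [AgasheRibetStein2006]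
-/

noncomputable section

open scoped MatrixGroups ModularForm

open CongruenceSubgroup Literature.NumberTheory.EllipticCurves.ModularForms

namespace Literature.NumberTheory.EllipticCurves

/-- **The Néron IMAGINARY period is a rational `2`-adic-unit multiple of the minus lattice period of the newform when `2 ∤ N` and `E[2]` is
irreducible** — the `Ω⁻` half of Greenberg–Vatsal 2000, §3, Remark 3.4, with the Manin constant at `p = 2 ∤ N` (Abbes–Ullmo 1996, Thm. A) and
Edixhoven 1991, Prop. 2 (`Λ(ω_{E₀}) = c₀Λ_f`); see the module docstring for the three-step chain read on imaginary parts. For a globally minimal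
elliptic `W/ℚ` with good reduction at `2` and `ρ̄_{E,2}` irreducible (`HasIrreducibleModPGaloisRep`), and the newform `f ∈ S₂(Γ₀(N))` of `W`
(`IsNewformOf W f`): there is `u ∈ ℚ` with `|u|₂ = 1` and `c_∞(W)·|Ω⁻(W)| = u·Ω⁻_f`, where `|Ω⁻(W)| = W.imaginaryPeriodRat` (Pal's `Ω⁻`, positive
generator of `Λ_W ∩ iℝ`), `c_∞(W) = numRealComponents (W ⊗ ℝ)` (so the left side is twice the positive generator of `im Λ_W`, components
included, in both lattice types) and `Ω⁻_f = minusPeriod f` (`im Λ_f = ℤ·Ω⁻_f/2`). Twin of `realPeriodRat_eq_unit_mul_plusPeriod_two`. Weaker than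
the sources (conclusion only up to a rational `2`-adic unit). Size L; no `_holds`.
[cite: GreenbergVatsal2000, §3, Remark 3.4; AbbesUllmo1996, Thm. A; EdixhovenManin1991, Prop. 2 and §1; Pal2012, p. 1514] -/
def numRealComponents_mul_imaginaryPeriodRat_eq_unit_mul_minusPeriod_two : Prop :=
  ∀ (W : WeierstrassCurve ℚ) [W.IsElliptic] [W.IsGloballyMinimal],
    W.HasGoodReductionAtPrime 2 → W.HasIrreducibleModPGaloisRep 2 →
    ∀ {N : ℕ} [NeZero N] (f : CuspForm (Gamma0 N) 2), IsNewformOf W f →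
    ∃ u : ℚ, ‖(u : ℚ_[2])‖ = 1 ∧ ((W.baseChange ℝ).numRealComponents : ℝ) * W.imaginaryPeriodRat = u * minusPeriod f

/-- **The Néron IMAGINARY period is a rational `2`-adic-unit multiple of the minus lattice period of the newform when `4 ∤ N` and `E[2]` is
irreducible** — the `Ω⁻` half of Greenberg–Vatsal 2000, §3, Remark 3.4 with the Manin constant at `p = 2`, `p² ∤ N` taken from Česnavičius 2018,
Thm. 1.2 («for a new elliptic optimal quotient `π : J_H ↠ E`, `Γ₁(n) ⊂ H ⊂ Γ₀(n)`, and a prime `p`: if `p² ∤ n` then `v_p(c_π) = 0`»; here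
`H = Γ₀(N)`, `p = 2`) in place of Abbes–Ullmo 1996 Thm. A, and Edixhoven 1991, Prop. 2 (`Λ(ω_{E₀}) = c₀Λ_f`); see the module docstring
(«The `4 ∤ N` variant») for the three-step chain read on imaginary parts.  For a globally minimal elliptic `W/ℚ` with `4 ∤ N_W` (good OR
multiplicative reduction at `2`) and `ρ̄_{E,2}` irreducible (`HasIrreducibleModPGaloisRep`), and the newform `f ∈ S₂(Γ₀(N))` of `W` (`IsNewformOf W f`):
there is `u ∈ ℚ` with `|u|₂ = 1` and `c_∞(W)·|Ω⁻(W)| = u·Ω⁻_f` (notation as in `numRealComponents_mul_imaginaryPeriodRat_eq_unit_mul_minusPeriod_two`,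
which is its special case `2 ∤ N_W`).  Requested by cell `bsd-f1-sign2` (-an g16 MEMO-an v1.39 AN-33♭, ask D-an-87: the hypothesis `hGV♭` of
`hSup_of_egg_notFourDvd` / `doorValueSupplyAtTwo_of_parts_notFourDvd`; statement = `MEMO-an-data/g16/Sketch_v35.lean` §14 verbatim).  Weaker than the
sources (conclusion only up to a rational `2`-adic unit).  Size L; no `_holds`.
[cite: Cesnavicius2018, Thm. 1.2] [cite: GreenbergVatsal2000, §3, Remark 3.4] [cite: EdixhovenManin1991, Prop. 2 and §1] [cite: Pal2012, p. 1514]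
[cite: AgasheRibetStein2006, Thm. 2.7] -/
def numRealComponents_mul_imaginaryPeriodRat_eq_unit_mul_minusPeriod_two_of_not_four_dvd : Prop :=
  ∀ (W : WeierstrassCurve ℚ) [W.IsElliptic] [W.IsGloballyMinimal],
    ¬ 4 ∣ W.conductorNorm ℤ → W.HasIrreducibleModPGaloisRep 2 →
    ∀ {N : ℕ} [NeZero N] (f : CuspForm (Gamma0 N) 2), IsNewformOf W f →
    ∃ u : ℚ, ‖(u : ℚ_[2])‖ = 1 ∧ ((W.baseChange ℝ).numRealComponents : ℝ) * W.imaginaryPeriodRat = u * minusPeriod f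

/-- **The Néron IMAGINARY period is a rational `p`-adic-unit multiple of the minus lattice period of the newform at an ODD prime `p ∤ N` with
`E[p]` irreducible** — the `Ω⁻` half of Greenberg–Vatsal 2000, §3, Remark 3.4 ("if `E` does not admit any `p`-isogenies, so that `E[p]` is
irreducible, then it is clear that the Néron periods of any isogenous curve differ from those of `E` by a `p`-adic unit" — stated for the
canonical periods `Ω_E^±` of BOTH signs), with the Manin constant at an ODD prime `p ∤ N` (Mazur 1978, Cor. 4.1: `p ∣ c₀ ⇒ p = 2 ∨ p² ∣ 4N`, void
for odd `p ∤ N`; also Abbes–Ullmo 1996, Thm. A) and Edixhoven 1991, Prop. 2 (`Λ(ω_{E₀}) = c₀Λ_f`): the module docstring's three-step chain read on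
imaginary parts, VERBATIM with `p` odd in place of `2` (step 2: `p ∤ c₀`; step 3: no rational `p`-isogeny in the class, so the Néron scaling `a`
and the imaginary-lattice index `e⁻` divide an isogeny degree prime to `p`). For a globally minimal elliptic `W/ℚ`, an ODD prime `p` of good
reduction with `ρ̄_{E,p}` irreducible (`HasIrreducibleModPGaloisRep`; automatic at a good supersingular `p`, Serre 1972 §1.11 Prop. 12), and the
newform `f ∈ S₂(Γ₀(N))` of `W` (`IsNewformOf W f`): there is `u ∈ ℚ` with `|u|_p = 1` and `c_∞(W)·|Ω⁻(W)| = u·Ω⁻_f` (notation as in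
`numRealComponents_mul_imaginaryPeriodRat_eq_unit_mul_minusPeriod_two`: `|Ω⁻(W)| = W.imaginaryPeriodRat`, `c_∞(W) = numRealComponents (W ⊗ ℝ)`,
`Ω⁻_f = minusPeriod f`). The odd-`p` twin of that fact and the `Ω⁻` twin of `realPeriodRat_eq_unit_mul_plusPeriod` /
`realPeriodRat_eq_unit_mul_plusPeriod_three` (file `ModularCurvePeriodRatio`); consumer: cell `bsd-potss`, crux stmt-BirchSwinnertonDyer-19606
(the period-ratio input `hper` of `Theorems/QuadraticBranchSignedControlPlusEtaNonsurjLambdaTransferBinder.lean` at `p ≡ 3 (mod 4)`, where the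
quadratic character `η = ω^{(p−1)/2}` is odd and the branch functions `L_p^±(E, η, X)` are normalised by `Ω⁻`). Weaker than the sources
(conclusion only up to a rational `p`-adic unit). Size L; no `_holds`.
[cite: GreenbergVatsal2000, §3, Remark 3.4] [cite: Mazur1978, Cor. 4.1] [cite: AbbesUllmo1996, Thm. A] [cite: EdixhovenManin1991, Prop. 2 and §1]
[cite: Pal2012, p. 1514] [cite: Serre1972, §1.11 Prop. 12] -/
def numRealComponents_mul_imaginaryPeriodRat_eq_unit_mul_minusPeriod_of_odd : Prop :=
  ∀ (W : WeierstrassCurve ℚ) [W.IsElliptic] [W.IsGloballyMinimal] (p : ℕ) [Fact p.Prime],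
    p ≠ 2 → W.HasGoodReductionAtPrime p → W.HasIrreducibleModPGaloisRep p →
    ∀ {N : ℕ} [NeZero N] (f : CuspForm (Gamma0 N) 2), IsNewformOf W f →
    ∃ u : ℚ, ‖(u : ℚ_[p])‖ = 1 ∧ ((W.baseChange ℝ).numRealComponents : ℝ) * W.imaginaryPeriodRat = u * minusPeriod f

end Literature.NumberTheory.EllipticCurves

end
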